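import Literature.NumberTheory.LFunctions.SiegelZeroFormSumAsymptoticCorollaryProofs
import Literature.NumberTheory.LFunctions.RealZeroRepulsionOddClassNumberHundred
import HarnessLib

/-!
# Pintz 1976 (II) Theorem 3 (`12/π`) and Schinzel's footnote (`16/π`) — DERIVED modulo Watkins'
# class-number table, with the odd half EXPLICIT: `1 − β > 18/√D` for every odd `D > 2 383 747`

Topic `Literature/NumberTheory/LFunctions` (namespace `Literature.NumberTheory.LFunctions`). Everything in this
file is PROVED (theorems only; no definition, no new named fact). Cell `parity-realchar` (SIEGEL INSTRUMENT,
conditionals row I.1): the two named facts `pintz1976_theorem3` / `pintz1976_theorem3_schinzel` of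
`GreatestRealZeroElementary.lean` (J. Pintz, Acta Arith. 31 (1976) 273–289, Theorem 3 p. 277 (1.24):
"For the greatest real zero `1 − δ` of an `L`-function belonging to a real primitive character modulo `D`,
the inequality `δ ≥ (12 − o(1))/(π√D)` holds"; footnote (2) p. 277, Schinzel: "`δ > (16/π − ε)/√D` if
`D > D₀(ε)` where `D₀(ε)` is effectively computable") are, as typed, `∃ D₀`-statements of strength `c/√D`
and hence voided by the tree's ineffective Siegel theorem (`Siegel.exists_one_sub_realZero_ge`; the
column's rule S6 keeps them NAMED as effective print records — CONDITIONALS v1.7n). Their EFFECTIVE content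
is assembled here from kernel theorems of the tree, modulo ONE published computational fact:

* EVEN characters (real quadratic fields): unconditional and effective in the kernel —
  `pintz1976_theorem3_even` / `pintz1976_theorem3_schinzel_even` (`SiegelZeroFormSumAsymptoticCorollaryProofs.lean`,
  from Goldfeld–Schinzel's Corollary for `d > 0`, whose `log D` gain dominates any constant);
* ODD characters (imaginary quadratic fields): Pintz's printed road (§4 pp. 284–285: Page / Theorem 5 /
  Theorem 2 and "the results of Baker [1]–[3] and Stark [17], [18] give that for `D ≥ D₀` (effective
  constant) `h(−D) ≥ 3`") needs the class-number-one and -two theorems, which the tree does not hold; in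
  their place the tree's class-summed Goldfeld–Schinzel inequality with the census `Σ_Q 1/a_Q ≤ h/30 + 6.26`
  gives `1 − β > 18/√D` as soon as `h(−D) ≥ 101`, i.e. — by Watkins' Table 4 (Math. Comp. 73 (2004): every
  imaginary quadratic field with `h ≤ 100` has `|d| ≤ 2 383 747`; tree named fact `watkins2004_table4`) —
  for EVERY odd `D > 2 383 747` (`ClassSumRepulsion.one_sub_realZero_gt_eighteen_of_watkins`). Since
  `18 > 16/π > 12/π`, both printed constants follow with the EXPLICIT threshold `2 383 748` on the odd side.

## Contents

* `pintz1976_theorem3_odd_explicit_of_watkins` — `watkins2004_table4 →` for every odd primitive quadratic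
  `χ` mod `D > 2 383 747` and every real `β < 1` with `L(β, χ) = 0`: `(16/π)/√D < 1 − β` (no `ε`, no `o(1)`).
* `pintz1976_theorem3_of_watkins : watkins2004_table4 → pintz1976_theorem3`;
  `pintz1976_theorem3_schinzel_of_watkins : watkins2004_table4 → pintz1976_theorem3_schinzel`.

LABEL (cell rule): conditionals row I.1 provenance; kernel modulo ONE published computational fact (Watkins
2004 Table 4, seven CPU-months, vendored AS PRINTED); NOT a discharge of the named facts (they stay NAMED as
effective print records). WHAT THIS IS NOT: not Pintz's proof of the odd half (Baker–Stark replaced by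
Watkins' table + Goldfeld–Schinzel); nothing here bears on parity (H5).

## References

* [Pintz1976ElementaryII] Theorem 3 p. 277 (1.24); footnote (2) p. 277 (Schinzel); §4 pp. 284–285.
* [Watkins2004ClassNumbers] M. Watkins, Math. Comp. 73 (2004) 907–938, Table 4 p. 936.
* [GoldfeldSchinzel1975] Theorem 1 and Corollary.
-/

noncomputable section

open Complex
open Literature.NumberTheory.QuadraticFields

namespace Literature.NumberTheory.LFunctions

open Pintz1976 ClassSumRepulsion

/-- `16/π < 18` and `12/π ≤ 16/π`. [folklore] -/
private theorem sixteen_div_pi_lt : 16 / Real.pi < 18 ∧ 12 / Real.pi ≤ 16 / Real.pi := by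
  have hπ := Real.pi_gt_three
  have hπ0 := Real.pi_pos
  constructor
  · rw [div_lt_iff₀ hπ0]; nlinarith
  · exact div_le_div_of_nonneg_right (by norm_num) hπ0.le

/-- **The odd half of Pintz's Theorem 3 / Schinzel's footnote, EXPLICIT, modulo Watkins' Table 4**: for every
odd primitive quadratic `χ` mod `D > 2 383 747` and every real zero `β < 1` of `L(s, χ)`,
`(16/π)/√D < 1 − β` (indeed `18/√D < 1 − β`). [cite: Pintz1976ElementaryII, footnote (2) p. 277]
[cite: Watkins2004ClassNumbers, Table 4 p. 936] -/
theorem pintz1976_theorem3_odd_explicit_of_watkins (hW : watkins2004_table4) {D : ℕ} [NeZero D]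
    (hD : 2383747 < D) {χ : DirichletCharacter ℂ D} (hquad : χ.IsQuadratic) (hprim : χ.IsPrimitive)
    (hodd : χ.Odd) {β : ℝ} (hβ1 : β < 1) (hz : χ.LFunction β = 0) :
    (16 / Real.pi) / Real.sqrt D < 1 - β := by
  have h18 := one_sub_realZero_gt_eighteen_of_watkins hW hD hprim hquad hodd hβ1 hz
  have hsd : 0 < Real.sqrt D := Real.sqrt_pos.2 (by exact_mod_cast (show 0 < D by omega))
  have hle : (16 / Real.pi) / Real.sqrt D ≤ 18 / Real.sqrt D :=
    div_le_div_of_nonneg_right sixteen_div_pi_lt.1.le hsd.le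
  exact lt_of_le_of_lt hle h18

/-- **Pintz 1976 (II), Theorem 3 — DERIVED modulo Watkins' Table 4** (`pintz1976_theorem3`, both parities:
even half unconditional from Goldfeld–Schinzel, odd half with the explicit threshold `2 383 748`).
[cite: Pintz1976ElementaryII, Theorem 3 p. 277 (1.24)] [cite: Watkins2004ClassNumbers, Table 4 p. 936] -/
theorem pintz1976_theorem3_of_watkins (hW : watkins2004_table4) : pintz1976_theorem3 := by
  intro ε hε
  obtain ⟨D₁, hD₁⟩ := pintz1976_theorem3_even ε
  refine ⟨max D₁ 2383748, fun D _ hD χ hquad hprim β hβ => ?_⟩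
  rcases χ.even_or_odd with heven | hodd
  · exact hD₁ D (le_trans (le_max_left _ _) hD) χ hquad hprim heven β hβ
  · have hD' : 2383747 < D := lt_of_lt_of_le (by norm_num) (le_trans (le_max_right _ _) hD)
    have h := pintz1976_theorem3_odd_explicit_of_watkins hW hD' hquad hprim hodd hβ.1 hβ.2.1
    have hsd : 0 < Real.sqrt D := Real.sqrt_pos.2 (by exact_mod_cast (show 0 < D by omega))
    have hle : (12 / Real.pi - ε) / Real.sqrt D ≤ (16 / Real.pi) / Real.sqrt D :=
      div_le_div_of_nonneg_right (by linarith [sixteen_div_pi_lt.2]) hsd.le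
    linarith

/-- **Schinzel's footnote (`16/π`) — DERIVED modulo Watkins' Table 4** (`pintz1976_theorem3_schinzel`, both
parities). [cite: Pintz1976ElementaryII, footnote (2) p. 277] [cite: Watkins2004ClassNumbers, Table 4 p. 936] -/
theorem pintz1976_theorem3_schinzel_of_watkins (hW : watkins2004_table4) : pintz1976_theorem3_schinzel := by
  intro ε hε
  obtain ⟨D₁, hD₁⟩ := pintz1976_theorem3_schinzel_even ε
  refine ⟨max D₁ 2383747, fun D _ hD χ hquad hprim β hβ => ?_⟩
  rcases χ.even_or_odd with heven | hodd
  · exact hD₁ D (le_of_lt (lt_of_le_of_lt (le_max_left _ _) hD)) χ hquad hprim heven β hβ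
  · have hD' : 2383747 < D := lt_of_le_of_lt (le_max_right _ _) hD
    have h := pintz1976_theorem3_odd_explicit_of_watkins hW hD' hquad hprim hodd hβ.1 hβ.2.1
    have hsd : 0 < Real.sqrt D := Real.sqrt_pos.2 (by exact_mod_cast (show 0 < D by omega))
    have hle : (16 / Real.pi - ε) / Real.sqrt D ≤ (16 / Real.pi) / Real.sqrt D :=
      div_le_div_of_nonneg_right (by linarith) hsd.le
    exact lt_of_le_of_lt hle h

end Literature.NumberTheory.LFunctions

end
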